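import Summits.HodgeConjecture.HodgeConjecture.Theses.EndoscopicMiddleDegree
import Literature.AlgebraicGeometry.HodgeTheory.CorrespondenceActionOfGraph
import Literature.AlgebraicGeometry.HodgeTheory.CorrespondenceComposition
import Literature.AlgebraicGeometry.Motives.ComplexPointsOrientation
import Literature.AlgebraicTopology.SingularHomology.PoincareDualityProofs
import HarnessLib

/-!
# Pull-back of algebraic classes along an arbitrary morphism is algebraic (stub
# `stub_pullbackAlgebraic` of line `Sketch`)

Support file for the crux `AlgebraicOrEnveloped` (item `stmt-HodgeConjecture-14943`) of the route
`Summits/HodgeConjecture/HodgeConjecture/Theses/EndoscopicMiddleDegree`, line `Sketch`. For a morphism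
`ι : X ⟶ X'` of smooth projective complex varieties (`dim X = d`, `dim X' = d'`) and an algebraic class
`y ∈ Nᵏ H²ᵏ(X'(ℂ); ℂ)`, the pull-back `ι^* y ∈ Nᵏ H²ᵏ(X(ℂ); ℂ)` is algebraic, GRANTED the route's
support item `CupProductAlgebraic` (cup products of algebraic classes are algebraic, Fulton 19.2 /
Voisin II Prop. 9.20). A general `ι` is not flat, so the proof is THE GRAPH TRICK (Fulton,
*Intersection Theory* §16.1, Prop. 16.1.2 (c): the transpose of the graph of `ι` acts as `ι^*`):
with `Γ = (𝟙, ι) : X ⟶ X ⊗ X'` and the graph class `[Γ] = Γ₊ 1 ∈ N^{d'} H^{2d'}((X ⊗ X')(ℂ); ℂ)`,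

  `ι^* y = pr₁₊(pr₂^* y ∪ [Γ])`

(projection formula `complexGysin_cup` for `Γ` read right to left, `∪ 1 = id`, `Γ ≫ pr₂ = ι`,
functoriality `complexGysin_comp` with `Γ ≫ pr₁ = 𝟙` and `complexGysin_id`; exactly the pattern of
`corrAction_gysinGraph_one` of `HodgeTheory/CorrespondenceActionOfGraph`), and the right-hand side
is algebraic in four tree steps:

1. `pr₂^* y ∈ Nᵏ` on `X ⊗ X'` (flat pull-back, `map_snd_mem_supportedClasses`);
2. `[Γ] ∈ N^{d'}` (`complexGysin_mem_supportedClasses` with the PROVED support property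
   `gysinMap_restrictCompl_eq_zero_of_field ℂ`, and `1 ∈ N⁰ H⁰ = H⁰`);
3. `pr₂^* y ∪ [Γ] ∈ N^{k+d'}` — the hypothesis `CupProductAlgebraic` on the smooth projective
   `X ⊗ X'` (`IsSmoothProjective.tensor_holds`);
4. `pr₁₊` of an algebraic class is algebraic (`complexGysin_mem_algebraicClasses`).

The orientation family with Poincaré duality is the complex one
(`Motives.ComplexPoints.isOrientableOver`, Hatcher Thm. 3.30 `poincare_duality`).
-/

noncomputable section

-- `Summit.HodgeConjecture.HodgeConjecture.Theorems` is the mandated namespace (single-problem summit),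
-- flagged by `linter.dupNamespace` on every declaration.
set_option linter.dupNamespace false

open CategoryTheory MonoidalCategory CartesianMonoidalCategory
open Literature.AlgebraicGeometry Literature.AlgebraicGeometry.Motives
open Literature.AlgebraicGeometry.HodgeTheory
open Literature.AlgebraicTopology.SingularHomology

namespace Summit.HodgeConjecture.HodgeConjecture.Theorems

/-- An orientation family with Poincaré duality exists: the complex orientations
(`Motives.ComplexPoints.isOrientableOver`) with Hatcher Thm. 3.30 (`poincare_duality`). -/
private theorem pullbackAlgebraic_exists_orientationFamily :
    ∃ μ : OrientationFamily, μ.HasPoincareDuality :=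
  ⟨fun _ _ h ↦ Classical.choice (ComplexPoints.isOrientableOver ℂ h),
    OrientationFamily.hasPoincareDuality_of (fun ν _ _ h ↦ poincare_duality ν h) _⟩

/-- **The transpose of a graph acts as the pull-back** (Fulton §16.1, Prop. 16.1.2 (c)): for
`ι : X ⟶ X'` (smooth projective, `dim X = d`, `dim X' = d'`), `Γ = (𝟙, ι) : X ⟶ X ⊗ X'` and
`y ∈ Hᵃ(X'(ℂ); ℂ)`, `pr₁₊(pr₂^* y ∪ Γ₊ 1) = ι^* y` in `Hᵃ(X(ℂ); ℂ)`: projection formula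
`pr₂^* y ∪ Γ₊ 1 = Γ₊(Γ^* pr₂^* y ∪ 1)` (`complexGysin_cup`), `∪ 1 = id`, `Γ^* pr₂^* = ι^*`
(`lift_snd`), `pr₁₊ Γ₊ = (Γ ≫ pr₁)₊ = (𝟙 X)₊ = id` (`complexGysin_comp`, `lift_fst`,
`complexGysin_id`). Exact for every orientation family with Poincaré duality. -/
theorem complexGysin_fst_cup_gysinGraph_one {μ : OrientationFamily} (hμ : μ.HasPoincareDuality)
    {d d' : ℕ} {X X' : SchemeOver ℂ} (hX : IsSmoothProjective d X) (hX' : IsSmoothProjective d' X')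
    (ι : X ⟶ X') {a b : ℕ} (hb : a + 2 * d' = b) (hab : b + 2 * d = a + 2 * (d + d'))
    (y : complexBetti X' a) :
    complexGysin μ (IsSmoothProjective.tensor_holds hX hX') hX (fst X X') hab
        (cupProduct hb (complexBetti.map (snd X X') a y)
          (complexGysin μ hX (IsSmoothProjective.tensor_holds hX hX') (lift (𝟙 X) ι)
            (show 0 + 2 * (d + d') = 2 * d' + 2 * d by omega)
            (singularCohomology.one ℂ (ComplexPoints X)))) =
      complexBetti.map ι a y := by
  have hXX' := IsSmoothProjective.tensor_holds hX hX'
  rw [← complexGysin_cup hμ hX hXX' (lift (𝟙 X) ι) (Nat.add_zero a)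
      (show a + 2 * (d + d') = b + 2 * d by omega)
      (show 0 + 2 * (d + d') = 2 * d' + 2 * d by omega) hb
      (complexBetti.map (snd X X') a y) (singularCohomology.one ℂ (ComplexPoints X)),
    cupProduct_one, ← CategoryTheory.comp_apply, ← complexBetti.map_comp, lift_snd,
    ← LinearMap.comp_apply (f := complexGysin μ hXX' hX (fst X X') _),
    ← complexGysin_comp hμ hX hXX' hX (lift (𝟙 X) ι) (fst X X')]
  simp only [lift_fst]
  rw [complexGysin_id hμ hX a, LinearMap.id_apply]

/-- **Pull-back of algebraic classes is algebraic** (stub `stub_pullbackAlgebraic` of line `Sketch`):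
for a morphism `ι : X ⟶ X'` of smooth projective complex varieties and `y ∈ Nᵏ H²ᵏ(X'(ℂ); ℂ)`,
`ι^* y ∈ Nᵏ H²ᵏ(X(ℂ); ℂ)`, GRANTED `CupProductAlgebraic`. Graph trick: `ι^* y = pr₁₊(pr₂^* y ∪ Γ₊ 1)`
(`complexGysin_fst_cup_gysinGraph_one`) with `pr₂^* y` algebraic (flat pull-back
`map_snd_mem_supportedClasses`), `Γ₊ 1` algebraic (`complexGysin_mem_supportedClasses`), their cup
product algebraic (`CupProductAlgebraic` on `X ⊗ X'`) and `pr₁₊` preserving algebraic classes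
(`complexGysin_mem_algebraicClasses` with `gysinMap_restrictCompl_eq_zero_of_field ℂ`). -/
theorem stub_pullbackAlgebraic (hcup : Theses.EndoscopicMiddleDegree.CupProductAlgebraic) :
    ∀ ⦃d d' : ℕ⦄ ⦃X X' : SchemeOver ℂ⦄, IsSmoothProjective d X → IsSmoothProjective d' X' →
    ∀ (ι : X ⟶ X') (k : ℕ) (y : complexBetti X' (2 * k)), y ∈ algebraicClasses X' k →
      complexBetti.map ι (2 * k) y ∈ algebraicClasses X k := by
  intro d d' X X' hX hX' ι k y hy
  obtain ⟨μ, hμ⟩ := pullbackAlgebraic_exists_orientationFamily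
  have hXX' := IsSmoothProjective.tensor_holds hX hX'
  rw [← complexGysin_fst_cup_gysinGraph_one hμ hX hX' ι (two_mul_add_two_mul k d')
      (show 2 * (k + d') + 2 * d = 2 * k + 2 * (d + d') by omega) y]
  refine complexGysin_mem_algebraicClasses (gysinMap_restrictCompl_eq_zero_of_field ℂ) μ hμ hXX' hX
    (fst X X') (q := k + d') (p := k) (by omega) _
    (hcup hXX' k d' _ _ (map_snd_mem_supportedClasses hX hX' hy) ?_)
  exact complexGysin_mem_supportedClasses (gysinMap_restrictCompl_eq_zero_of_field ℂ) μ hμ hX hXX'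
    (lift (𝟙 X) ι) _ (r := 0) (by omega) (by rw [supportedClasses_zero]; exact Submodule.mem_top)

end Summit.HodgeConjecture.HodgeConjecture.Theorems

end
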